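import Mathlib
import Summits.NavierStokesRegularity.NavierStokesRegularity.Theorems.StretchingWellBindingEnstrophyQuarterLawSparsenessCore
import Summits.NavierStokesRegularity.NavierStokesRegularity.Theorems.StretchingWellBindingEnstrophyQuarterLawTypeICore
import Summits.NavierStokesRegularity.NavierStokesRegularity.Theorems.StretchingWellBindingEnstrophyQuarterLawRegisteredStatus
import Summits.NavierStokesRegularity.NavierStokesRegularity.Theorems.StretchingWellBindingEnstrophyQuarterLawSparsenessEarly
import HarnessLib

/-!
# Shelf crux `EnstrophyQuarterLaw` (stmt-NavierStokesRegularity-1574), line «sparse_sieve»: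
# `EnstrophyQuarterLaw ⟺ stub_noTypeII ∧ (parabolic near-field late swarms are bounded)`

Helper file (`--supports stmt-NavierStokesRegularity-1574 --as helper`). Composition of the unconditional
reshaping `SparsenessCore.uniformSparseness_iff_core` (p818258), the Type-I parabolic floor
`TypeICore.no_concentration_below_parabolic_scale` (p818328), the early-time count
`SparsenessEarly.sparse_early_of_lerayHopf` (p814773) and the exact status
`Registered.enstrophyQuarterLaw_iff_stub_noTypeII_and_stub_uniformSparseness` (p817733):

* `uniformSparseness_iff_parabolicCore` — for a first blow-up that is sup-rate Type I (`IsTypeIBlowup u T`), the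
  registered stub predicate `UniformSparseness T u` is equivalent to its PARABOLIC CORE: for EVERY cutoff `c₁ > 0`
  and radius `ρ`, a scale `r₁` and per-threshold bounds `N₁(ε₀)` on `4r`-separated `ε₀`-concentrating families with
  centres `‖x‖ < ρ`, at late times `t ∈ [T/2,T)`, scales `c₁ ε₀ √(T−t) ≤ r ≤ r₁` above the enstrophy scale
  (`r · Z(t) > c₀ ε₀²`);
* `enstrophyQuarterLaw_iff_stub_noTypeII_and_parabolicCore` — **`EnstrophyQuarterLaw ⟺ TypeIliouvilleNoTypeII ∧
  (∀ first blow-ups, parabolic core)`**: beyond the sibling crux 0056, the quarter law IS the boundedness of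
  PARABOLIC-OR-COARSER, NEAR-FIELD, LATE, HIGH-ENSTROPHY satellite swarms — the sharpest form of the census reading
  `EQL ⟺ U ∧ S2∀` available from the landed unconditional pieces.

HONEST FRAMING: equivalences between OPEN statements (1574, 0056, S2); nothing here bears on Navier–Stokes
regularity; no summit statement is proved.
-/

noncomputable section

-- the summit and its single sub-problem share the name (CONVENTIONS §1), as in every Theorems file
set_option linter.dupNamespace false

namespace Summit.NavierStokesRegularity.NavierStokesRegularity.Theorems.EnstrophyQuarterLaw.ParabolicCore

open MeasureTheory Set Metric
open Literature.Analysis Literature.Analysis.FluidPDE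
open Summit.NavierStokesRegularity.NavierStokesRegularity.Theorems.EnstrophyQuarterLaw.SparseSieve
open scoped ENNReal NNReal

/-- **On the Type-I shelf, `UniformSparseness ⟺ its parabolic core`** (one absolute `c₀`; every first blow-up
with `IsTypeIBlowup u T`). `→`: restriction. `←`: below the parabolic scale `c₁'ε₀√(T−t)` of `TypeICore` there is no
concentrating ball on `(t₁', T)`, the times `[T/2, t₁']` are early (`SparsenessEarly` up to `max t₁' (T/2)`), and
the rest is the hypothesis at the cutoff `c₁'`; then `SparsenessCore.uniformSparseness_iff_core`. [folklore] -/
theorem uniformSparseness_iff_parabolicCore :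
    ∃ c₀ : ℝ, 0 < c₀ ∧ ∀ (ν T : ℝ), 0 < ν → 0 < T →
      ∀ (u : ℝ → EuclideanSpace ℝ (Fin 3) → EuclideanSpace ℝ (Fin 3))
        (p : ℝ → EuclideanSpace ℝ (Fin 3) → ℝ),
      IsMaximalSmoothSolution ν 0 u p T → IsLerayHopfOn T ν 0 (u 0) u →
      HasRapidSpatialDecay (u 0) → IsTypeIBlowup u T →
      (UniformSparseness T u ↔
        ∀ c₁ : ℝ, 0 < c₁ → ∀ ρ : ℝ, 0 < ρ → ∃ r₁ : ℝ, 0 < r₁ ∧ ∀ ε₀ : ℝ, 0 < ε₀ → ∃ N₁ : ℕ,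
          ∀ t ∈ Set.Ico (T / 2) T, ∀ r ∈ Set.Ioc 0 r₁,
            c₀ * ε₀ ^ 2 < r * (∫⁻ y, ‖curl (u t) y‖ₑ ^ 2).toReal →
            c₁ * ε₀ * Real.sqrt (T - t) ≤ r →
            ∀ F : Finset (EuclideanSpace ℝ (Fin 3)),
              (∀ x ∈ F, ∀ y ∈ F, x ≠ y → 4 * r ≤ dist x y) →
              (∀ x ∈ F, ENNReal.ofReal (ε₀ ^ 3) ≤ ∫⁻ y in Metric.ball x (2 * r), ‖u t y‖ₑ ^ 3) →
              (∀ x ∈ F, ‖x‖ < ρ) → F.card ≤ N₁) := by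
  classical
  obtain ⟨c₀, hc₀, hcore⟩ := SparsenessCore.uniformSparseness_iff_core
  refine ⟨c₀, hc₀, fun ν T hν hT u p hmax hLH hdec hI => ⟨fun hS => ?_, fun hpar => ?_⟩⟩
  · -- `→`: restriction of the core
    have h := (hcore ν T hν hT u p hmax hLH hdec).1 hS
    intro c₁ _ ρ hρ
    obtain ⟨r₁, hr₁, hN⟩ := h ρ hρ
    refine ⟨r₁, hr₁, fun ε₀ hε₀ => ?_⟩
    obtain ⟨N₁, hN₁⟩ := hN ε₀ hε₀
    exact ⟨N₁, fun t ht r hr hhigh _ F hsep hconc hnear => hN₁ t ht r hr hhigh F hsep hconc hnear⟩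
  · -- `←`: fill the sub-parabolic scales (Type I) and the times before `t₁'` (early), then the core
    have hsol : IsClassicalNSSolutionOn (Ico 0 T) ν 0 u p := hmax.1
    obtain ⟨c₁, t₁, hc₁, ht₁, hTI⟩ := TypeICore.no_concentration_below_parabolic_scale hI
    set T' : ℝ := max t₁ (T / 2) with hT'
    have hT'I : T' ∈ Ioo 0 T := ⟨lt_of_lt_of_le (by positivity) (le_max_right _ _), max_lt ht₁ (by linarith)⟩
    have hearly := SparsenessEarly.sparse_early_of_lerayHopf hν hsol hLH hdec hT'I
    refine (hcore ν T hν hT u p hmax hLH hdec).2 fun ρ hρ => ?_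
    obtain ⟨r₁, hr₁, hN⟩ := hpar c₁ hc₁ ρ hρ
    refine ⟨r₁, hr₁, fun ε₀ hε₀ => ?_⟩
    obtain ⟨N₁, hN₁⟩ := hN ε₀ hε₀
    obtain ⟨Ne, hNe⟩ := hearly ε₀ hε₀
    refine ⟨N₁ + Ne, fun t ht r hr hhigh F hsep hconc hnear => ?_⟩
    by_cases hlate : t₁ < t
    · by_cases hparab : c₁ * ε₀ * Real.sqrt (T - t) ≤ r
      · have h1 := hN₁ t ht r hr hhigh hparab F hsep hconc hnear
        omega
      · -- below the parabolic scale: no concentrating ball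
        have hempty : F.card = 0 := by
          rw [Finset.card_eq_zero, Finset.eq_empty_iff_forall_notMem]
          intro x hx
          exact absurd (hconc x hx)
            (not_le.2 (hTI ε₀ hε₀ t ⟨hlate, ht.2⟩ x r hr.1 (not_le.1 hparab).le))
        omega
    · have h3 := hNe t ⟨le_trans (by positivity) ht.1, (not_lt.1 hlate).trans (le_max_left _ _)⟩ r hr.1
        F hsep hconc
      omega

/-- **`EnstrophyQuarterLaw ⟺ stub_noTypeII ∧ (∀ first blow-ups, the PARABOLIC CORE of S2)`.** With one absolute
`c₀`: the quarter law at every first blow-up holds iff every first blow-up is sup-rate Type I (stmt-0056, stub 6)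
AND, at every first blow-up, for every parabolic cutoff `c₁ > 0` and radius `ρ`, the `4r`-separated
`ε₀`-concentrating families with centres in `B(0,ρ)` at late times and scales `c₁ε₀√(T−t) ≤ r ≤ r₁`,
`r·Z(t) > c₀ε₀²`, are bounded by some `N₁(ε₀)`. (`Registered.enstrophyQuarterLaw_iff_stub_noTypeII_and_stub_uniformSparseness`
+ `uniformSparseness_iff_parabolicCore`, the Type-I hypothesis being supplied by 0056 itself.) Equivalence of
OPEN statements; no summit statement is proved. [folklore] -/
theorem enstrophyQuarterLaw_iff_stub_noTypeII_and_parabolicCore :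
    ∃ c₀ : ℝ, 0 < c₀ ∧
      (Summit.NavierStokesRegularity.NavierStokesRegularity.Theses.StretchingWellBinding.EnstrophyQuarterLaw ↔
        (Summit.NavierStokesRegularity.NavierStokesRegularity.Theses.TypeILiouville.TypeIliouvilleNoTypeII ∧
         ∀ (ν T : ℝ), 0 < ν → 0 < T →
          ∀ (u : ℝ → EuclideanSpace ℝ (Fin 3) → EuclideanSpace ℝ (Fin 3))
            (p : ℝ → EuclideanSpace ℝ (Fin 3) → ℝ),
          IsMaximalSmoothSolution ν 0 u p T → IsLerayHopfOn T ν 0 (u 0) u →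
          HasRapidSpatialDecay (u 0) →
          ∀ c₁ : ℝ, 0 < c₁ → ∀ ρ : ℝ, 0 < ρ → ∃ r₁ : ℝ, 0 < r₁ ∧ ∀ ε₀ : ℝ, 0 < ε₀ → ∃ N₁ : ℕ,
            ∀ t ∈ Set.Ico (T / 2) T, ∀ r ∈ Set.Ioc 0 r₁,
              c₀ * ε₀ ^ 2 < r * (∫⁻ y, ‖curl (u t) y‖ₑ ^ 2).toReal →
              c₁ * ε₀ * Real.sqrt (T - t) ≤ r →
              ∀ F : Finset (EuclideanSpace ℝ (Fin 3)),
                (∀ x ∈ F, ∀ y ∈ F, x ≠ y → 4 * r ≤ dist x y) →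
                (∀ x ∈ F, ENNReal.ofReal (ε₀ ^ 3) ≤ ∫⁻ y in Metric.ball x (2 * r), ‖u t y‖ₑ ^ 3) →
                (∀ x ∈ F, ‖x‖ < ρ) → F.card ≤ N₁)) := by
  obtain ⟨c₀, hc₀, hpc⟩ := uniformSparseness_iff_parabolicCore
  refine ⟨c₀, hc₀, ?_⟩
  rw [Registered.enstrophyQuarterLaw_iff_stub_noTypeII_and_stub_uniformSparseness]
  refine ⟨fun h => ⟨h.1, fun ν T hν hT u p hmax hLH hdec => ?_⟩, fun h => ⟨h.1, fun ν T hν hT u p hmax hLH hdec => ?_⟩⟩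
  · exact (hpc ν T hν hT u p hmax hLH hdec (h.1 ν T hν hT u p hmax hLH hdec)).1
      (h.2 ν T hν hT u p hmax hLH hdec)
  · exact (hpc ν T hν hT u p hmax hLH hdec (h.1 ν T hν hT u p hmax hLH hdec)).2
      (h.2 ν T hν hT u p hmax hLH hdec)

end Summit.NavierStokesRegularity.NavierStokesRegularity.Theorems.EnstrophyQuarterLaw.ParabolicCore

end
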